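import Summits.Ventures.HodgeKum4.Theorems.KummerFixedLocusL1HilbJoinPolarWords
import Summits.Ventures.HodgeKum4.Theorems.KummerFixedLocusL1HilbSeam
import HarnessLib

/-!
# Lane (V), line v2p5 — stub S-F (`stub_span`), JOIN half, part 3: **J2 `PolarReach`** on the tree's carriers

Cell `hodge-kum4`, crux stmt-Ventures-20306 (`LefschetzGenerationHilb5`, W-form); cut of record (director-hodge g8 13:00:29Z,
plan g19 `SeamSF.v2.PLAN` e3a3fc3607265de7): **(J2) if `W ⊆ H*(S^[n])` contains every all-unit Nakajima monomial
(`SF.monBasis … ρ` for `ρ` supported on the colour of `i₀`, `b i₀ = 1_S`) and is stable under the polarisations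
`τ_k(b_i ⊗ b_{i₀}^∨)|ₙ` (`1 ≤ k ≤ n`, `i ≠ i₀`), then `W` contains every Nakajima monomial.**  Statement `SF.polarReach` =
the plan's `PolarReach` VERBATIM (hypotheses and conclusion over `SF.monBasis`, `L1Hilb.twoPt`, `L1Hilb.polar`).

Proof: transport to `ℍ = ⨁ₘ H*(S^[m])` along `Ŵ = W.map (ℍₙ ↪ ℍ)` and apply the Fock-space form
`Join.heisenbergMonomial_mem_of_polar` (part 2): the bridge facts are (i) `transferTerm` preserves `ℍₙ` (bi-degree axiom), so
`twoPt`-stability of `W` is `τ_k`-stability of `Ŵ`; (ii) `polar b i₀ i` maps the basis letter `b_{i₀}` to `b_i` and kills the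
others, and has parity `deg i` (the coordinate `b_{i₀}^∨` vanishes off `H⁰` because the basis is homogeneous —
`repr_eq_zero_of_deg_ne`, and `deg i₀ = 0` because `b i₀ = 1_S ∈ H⁰` is a non-zero basis vector); (iii)
`SF.monBasis … ρ` read in `ℍ` is the Heisenberg monomial of `ρ` (`heisenbergMonomialBasisSummand_apply`).

HONEST FRAMING: J2 only; nothing here asserts S-F ∕ `SF.JoinHalf` ∕ L1-Hilb(n) ∕ L1 ∕ HC_Kum4Type ∕ HC.
-/

noncomputable section

open scoped TensorProduct DirectSum
open DirectSum
open Literature.AlgebraicTopology.SingularHomology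
open Literature.AlgebraicGeometry Literature.AlgebraicGeometry.Hyperkaehler Literature.AlgebraicGeometry.HilbertScheme
open Literature.AlgebraicGeometry.Motives (ComplexPoints SchemeOver IsSmoothProjective)

namespace Summit.Ventures.HodgeKum4.L1Hilb.SF

open Summit.Ventures.HodgeKum4.L1Hilb Summit.Ventures.HodgeKum4.L1Hilb.Join

universe u

/-! ### Homogeneous bases of a graded space -/

section Homogeneous

variable {Y : Type u} [TopologicalSpace Y] {ι : Type} (b : Module.Basis ι ℂ (totalCohomology ℂ Y)) (deg : ι → ℕ)

/-- **The coordinates of a homogeneous vector in a homogeneous basis live in its degree**: if `b i ∈ H^{deg i}` for all `i`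
and `v ∈ Hʲ`, then `b.repr v i = 0` unless `deg i = j`. -/
theorem repr_eq_zero_of_deg_ne [Fintype ι] (hb : ∀ i, b i ∈ LinearMap.range (ofDegree ℂ Y (deg i))) {j : ℕ}
    {v : totalCohomology ℂ Y} (hv : v ∈ LinearMap.range (ofDegree ℂ Y j)) {i : ι} (hi : deg i ≠ j) : b.repr v i = 0 := by
  classical
  set d := deg i with hd
  -- `lof d ∘ component d` kills `v` (`d ≠ j`) and is the identity on the `b i'` of degree `d`, zero on the others
  let π : totalCohomology ℂ Y →ₗ[ℂ] totalCohomology ℂ Y :=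
    ofDegree ℂ Y d ∘ₗ DirectSum.component ℂ ℕ (fun k ↦ singularCohomology ℂ ℂ Y k) d
  have hπb : ∀ i', π (b i') = if deg i' = d then b i' else 0 := by
    intro i'
    obtain ⟨y, hy⟩ := hb i'
    rw [← hy]
    simp only [π, LinearMap.comp_apply]
    by_cases h : deg i' = d
    · rw [if_pos h, ← h, DirectSum.component.lof_self]
    · rw [if_neg h, ofDegree, DirectSum.component.of, dif_neg h, map_zero]
  have hπv : π v = 0 := by
    obtain ⟨y, hy⟩ := hv
    rw [← hy]
    simp only [π, LinearMap.comp_apply]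
    rw [ofDegree, DirectSum.component.of, dif_neg (fun h ↦ hi (hd ▸ h.symm)), map_zero]
  -- expand `v` in the basis and apply `π`
  have hsum : ∑ i' ∈ Finset.univ.filter (fun i' ↦ deg i' = d), b.repr v i' • b i' = 0 := by
    have := congrArg π (b.sum_repr v)
    rw [hπv, map_sum] at this
    simp only [map_smul, hπb, smul_ite, smul_zero] at this
    rwa [Finset.sum_ite, Finset.sum_const_zero, add_zero] at this
  have hli := (linearIndependent_iff'.1 b.linearIndependent) _ _ hsum i (by simp [hd])
  exact hli

end Homogeneous

/-! ### The polarisation `b_i ⊗ b_{i₀}^∨` -/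

section Polar

variable {S : SchemeOver ℂ} {ι : Type} (b : Module.Basis ι ℂ (totalCohomology ℂ (ComplexPoints S))) (i₀ i : ι)

/-- `polar b i₀ i` sends the basis vector `b i₀` to `b i` and every other basis vector to `0`. -/
theorem polar_apply_basis [DecidableEq ι] (i' : ι) : polar b i₀ i (b i') = if i' = i₀ then b i else 0 := by
  rw [polar, LinearMap.smulRight_apply, Module.Basis.coord_apply, Module.Basis.repr_self, Finsupp.single_apply]
  by_cases h : i' = i₀
  · rw [if_pos h, if_pos h, one_smul]
  · rw [if_neg h, if_neg h, zero_smul]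

/-- **`polar b i₀ i` has parity `deg i`** when the basis is homogeneous and `deg i₀ = 0`: it maps `Hʲ` into the classes of
parity `j + deg i` (it vanishes off `H⁰` and maps `H⁰` into `ℂ · b i ⊆ H^{deg i}`). -/
theorem polar_mem_paritySpan [Fintype ι] (deg : ι → ℕ)
    (hb : ∀ i, b i ∈ LinearMap.range (ofDegree ℂ (ComplexPoints S) (deg i))) (h0 : deg i₀ = 0) (j : ℕ)
    (ε : coeffFamily S j) :
    polar b i₀ i (lof ℂ ℕ (coeffFamily S) j ε) ∈ paritySpan ℂ (coeffFamily S) (j + deg i) := by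
  rw [polar, LinearMap.smulRight_apply, Module.Basis.coord_apply]
  by_cases hj : deg i₀ = j
  · refine Submodule.smul_mem _ _ ?_
    obtain ⟨y, hy⟩ := hb i
    rw [← hy]
    have hev : Even (deg i + (j + deg i)) := ⟨deg i, by omega⟩
    exact lof_mem_paritySpan (K := ℂ) (A := coeffFamily S) hev y
  · rw [repr_eq_zero_of_deg_ne b deg hb ⟨ε, rfl⟩ hj, zero_smul]
    exact Submodule.zero_mem _

end Polar

/-! ### `transferTerm` preserves `ℍₙ` -/

section Transfer

variable {S : SchemeOver ℂ} {hS : IsSmoothProjective 2 S} {H : HilbertSchemesOfPoints S}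

/-- **A transfer term `τ_k(φ) = Σᵢ 𝔮_k(φ εᵢ) 𝔮₋ₖ(eᵢ)` preserves the summand `ℍₙ`** (`k ≤ n`; bi-degree axiom twice). -/
theorem transferTerm_apply_ofSummand_mem_range (𝔑 : NakajimaOperators hS H)
    (C : totalCohomology ℂ (ComplexPoints S) ⊗[ℂ] totalCohomology ℂ (ComplexPoints S))
    (φ : Module.End ℂ (totalCohomology ℂ (ComplexPoints S))) {k n : ℕ} (hkn : k ≤ n)
    (y : FockSummand (fockFamily H) n) :
    transferTerm ℂ 𝔑.q C φ k (Fock.ofSummand ℂ (fockFamily H) n y) ∈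
      LinearMap.range (Fock.ofSummand ℂ (fockFamily H) n) := by
  induction C using TensorProduct.induction_on with
  | zero => simp [transferTerm]
  | tmul e ε =>
    rw [transferTerm_tmul, Module.End.mul_apply]
    obtain ⟨z, hz⟩ := 𝔑.isHeisenberg.apply_ofSummand_mem_range (-(k : ℤ)) e (p := n) (p' := n - k) (by omega) y
    rw [← hz]
    exact 𝔑.isHeisenberg.apply_ofSummand_mem_range (k : ℤ) (φ ε) (p := n - k) (p' := n) (by omega) z
  | add C C' hC hC' =>
    have : transferTerm ℂ 𝔑.q (C + C') φ k = transferTerm ℂ 𝔑.q C φ k + transferTerm ℂ 𝔑.q C' φ k := by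
      simp [transferTerm, map_add]
    rw [this, LinearMap.add_apply]
    exact Submodule.add_mem _ hC hC'

/-- `twoPt` read in `ℍ`: for `w ∈ ℍₙ`, `τ_k(φ)(w) = (twoPt 𝔑 C φ k n w)` placed in `ℍₙ` (`k ≤ n`). -/
theorem ofSummand_twoPt (𝔑 : NakajimaOperators hS H)
    (C : totalCohomology ℂ (ComplexPoints S) ⊗[ℂ] totalCohomology ℂ (ComplexPoints S))
    (φ : Module.End ℂ (totalCohomology ℂ (ComplexPoints S))) {k n : ℕ} (hkn : k ≤ n)
    (w : totalCohomology ℂ (ComplexPoints (H.obj n))) :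
    Fock.ofSummand ℂ (fockFamily H) n (twoPt 𝔑 C φ k n w) =
      transferTerm ℂ 𝔑.q C φ k (Fock.ofSummand ℂ (fockFamily H) n w) := by
  classical
  obtain ⟨z, hz⟩ := transferTerm_apply_ofSummand_mem_range 𝔑 C φ hkn w
  rw [twoPt, restrictFock, LinearMap.comp_apply, LinearMap.comp_apply, ← hz, DirectSum.component.lof_self]

end Transfer

/-! ### J2 -/

variable {S : SchemeOver ℂ} {hS : IsSmoothProjective 2 S} {H : HilbertSchemesOfPoints S}

/-- `SF.monBasis … ρ`, read in `ℍ`, is the Heisenberg monomial of `ρ` for the reindexed basis `b ∘ (equivFin ι)⁻¹`. -/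
theorem ofSummand_monBasis (𝔑 : NakajimaOperators hS H) {ι : Type} [Fintype ι]
    (b : Module.Basis ι ℂ (totalCohomology ℂ (ComplexPoints S))) (deg : ι → ℕ)
    (hb : ∀ i, b i ∈ LinearMap.range (ofDegree ℂ (ComplexPoints S) (deg i))) (n : ℕ)
    (ρ : {ρ : Fin (Fintype.card ι) → Fin (n + 1) → ℕ // IsPartitionValued (deg ∘ (Fintype.equivFin ι).symm) n ρ}) :
    Fock.ofSummand ℂ (fockFamily H) n (monBasis 𝔑 b deg hb n ρ) =
      heisenbergMonomial 𝔑.q (vacuumVector H) (⇑b ∘ (Fintype.equivFin ι).symm) n ρ.1 :=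
  𝔑.heisenbergMonomialBasisSummand_apply _ _ _ n ρ

/-- **(J2) `PolarReach` — polarisations reach every Nakajima monomial from the all-unit ones** (plan g19
`SeamSF.v2.PLAN` e3a3fc3607265de7, statement verbatim): for Nakajima operators `𝔑`, an even Casimir tensor `C` of the
Poincaré pairing, a homogeneous basis `b` of `H*(S)` with `b i₀ = 1_S`, and `W ⊆ H*(S^[n])` containing `SF.monBasis … ρ` for
every `ρ` supported on the colour of `i₀` and stable under all `twoPt 𝔑 C (polar b i₀ i) k n` (`1 ≤ k ≤ n`, `i ≠ i₀`):
`SF.monBasis … ρ ∈ W` for every `ρ`. -/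
theorem polarReach :
    ∀ ⦃S : SchemeOver ℂ⦄ ⦃hS : IsSmoothProjective 2 S⦄ ⦃H : HilbertSchemesOfPoints S⦄ (𝔑 : NakajimaOperators hS H)
    (C : totalCohomology ℂ (ComplexPoints S) ⊗[ℂ] totalCohomology ℂ (ComplexPoints S)),
    C ∈ evenTensorSpan ℂ (coeffFamily S) → IsCasimir ℂ (poincarePairing hS) C →
    ∀ {ι : Type} [Fintype ι] [DecidableEq ι] (b : Module.Basis ι ℂ (totalCohomology ℂ (ComplexPoints S))) (i₀ : ι),
      b i₀ = unitCoeff S →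
    ∀ (deg : ι → ℕ) (hb : ∀ i, b i ∈ LinearMap.range (ofDegree ℂ (ComplexPoints S) (deg i)))
      (n : ℕ) (W : Submodule ℂ (totalCohomology ℂ (ComplexPoints (H.obj n)))),
      (∀ ρ : {ρ : Fin (Fintype.card ι) → Fin (n + 1) → ℕ // IsPartitionValued (deg ∘ (Fintype.equivFin ι).symm) n ρ},
        (∀ c, c ≠ Fintype.equivFin ι i₀ → ∀ r, ρ.1 c r = 0) → monBasis 𝔑 b deg hb n ρ ∈ W) →
      (∀ k, 1 ≤ k → k ≤ n → ∀ i, i ≠ i₀ → ∀ w ∈ W, twoPt 𝔑 C (polar b i₀ i) k n w ∈ W) →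
      ∀ ρ, monBasis 𝔑 b deg hb n ρ ∈ W := by
  intro S hS H 𝔑 C hCg hC ι _ _ b i₀ hb0 deg hb n W hunit hP ρ
  classical
  -- the unit colour has degree `0`: `b i₀ = 1_S ∈ H⁰` is a non-zero basis vector
  have hdeg0 : deg i₀ = 0 := by
    by_contra hne
    have h1 : b.repr (b i₀) i₀ = 0 :=
      repr_eq_zero_of_deg_ne b deg hb (j := 0) ⟨_, hb0.symm⟩ hne
    rw [Module.Basis.repr_self, Finsupp.single_eq_same] at h1
    exact one_ne_zero h1
  let e := Fintype.equivFin ι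
  let x : Fin (Fintype.card ι) → totalCohomology ℂ (ComplexPoints S) := ⇑b ∘ e.symm
  let deg' : Fin (Fintype.card ι) → ℕ := deg ∘ e.symm
  let c₀ : Fin (Fintype.card ι) := e i₀
  have hx : ∀ c, x c ∈ LinearMap.range (lof ℂ ℕ (coeffFamily S) (deg' c)) := fun c ↦ hb (e.symm c)
  have hc₀ : deg' c₀ = 0 := by
    show deg (e.symm (e i₀)) = 0
    rw [Equiv.symm_apply_apply]
    exact hdeg0
  have hsymm : ∀ c, c ≠ c₀ → e.symm c ≠ i₀ := fun c hc h ↦ hc (by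
    show c = e i₀
    rw [← h, Equiv.apply_symm_apply])
  -- the polarisations as a family indexed by colours
  let φ : Fin (Fintype.card ι) → Module.End ℂ (totalCohomology ℂ (ComplexPoints S)) := fun c ↦ polar b i₀ (e.symm c)
  have hφ : ∀ c (j : ℕ) (ε : coeffFamily S j),
      φ c (lof ℂ ℕ (coeffFamily S) j ε) ∈ paritySpan ℂ (coeffFamily S) (j + deg' c) :=
    fun c j ε ↦ polar_mem_paritySpan b i₀ (e.symm c) deg hb hdeg0 j ε
  have hφ₀ : ∀ c, φ c (x c₀) = x c := fun c ↦ by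
    show polar b i₀ (e.symm c) (b (e.symm (e i₀))) = b (e.symm c)
    rw [Equiv.symm_apply_apply, polar_apply_basis, if_pos rfl]
  have hφ₁ : ∀ c c', c' ≠ c₀ → φ c (x c') = 0 := fun c c' hc' ↦ by
    show polar b i₀ (e.symm c) (b (e.symm c')) = 0
    rw [polar_apply_basis, if_neg (hsymm c' hc')]
  -- the transported subspace `Ŵ ⊆ ℍ`
  let Ŵ : Submodule ℂ (fockSpace H) := W.map (Fock.ofSummand ℂ (fockFamily H) n)
  have hunit' : ∀ ρ' : Fin (Fintype.card ι) → Fin (n + 1) → ℕ, IsPartitionValued deg' n ρ' →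
      (∀ c, c ≠ c₀ → ∀ r, ρ' c r = 0) → heisenbergMonomial 𝔑.q (vacuumVector H) x n ρ' ∈ Ŵ := by
    intro ρ' hρ' hsupp
    rw [← ofSummand_monBasis 𝔑 b deg hb n ⟨ρ', hρ'⟩]
    exact Submodule.mem_map_of_mem (hunit ⟨ρ', hρ'⟩ hsupp)
  have hstable : ∀ c, c ≠ c₀ → ∀ k : ℕ, 1 ≤ k → k ≤ n → ∀ v ∈ Ŵ, transferTerm ℂ 𝔑.q C (φ c) k v ∈ Ŵ := by
    intro c hc k hk1 hkn v hv
    obtain ⟨w, hw, rfl⟩ := Submodule.mem_map.1 hv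
    rw [← ofSummand_twoPt 𝔑 C (φ c) hkn w]
    exact Submodule.mem_map_of_mem (hP k hk1 hkn (e.symm c) (hsymm c hc) w hw)
  -- Fock-space J2
  have hmem := heisenbergMonomial_mem_of_polar (K := ℂ) (A := coeffFamily S) (Φ := fockFamily H) 𝔑.isHeisenberg
    (poincarePairing_graded_symm hS) hCg hC hx hc₀ φ hφ hφ₀ hφ₁ Ŵ hunit' hstable ρ.2
  rw [← ofSummand_monBasis 𝔑 b deg hb n ρ] at hmem
  obtain ⟨w, hw, heq⟩ := Submodule.mem_map.1 hmem
  rwa [← Fock.ofSummand_injective (K := ℂ) (Φ := fockFamily H) n heq]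

end Summit.Ventures.HodgeKum4.L1Hilb.SF

end
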